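import Literature.AlgebraicGeometry.Motives.WeilJacobianGlue
import Literature.AlgebraicGeometry.Motives.GeometricallyIntegralAlgClosed
import HarnessLib

/-!
# Weil's construction of the Jacobian, II: the map `σ : Cᵍ → J`, properness and integrality

Continuing `Motives/WeilJacobianGlue` (Milne, *Jacobian Varieties*, §7, proof of Thm. 7.1): let
`J` be the `K`-scheme glued from the copies `W_R` of the chart `W ⊆ C⁽ᵍ⁾`, and fix a `g`-tuple
`R₀` of `K`-points of `C`. We construct the morphism

  `σ : Cᵍ → J`, `τ = (Q₁, …, Q_g) ↦ [Σⱼ [Qⱼ] − Σ[R₀]]`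

and derive the global properties of `J`.

* `WeilJacobian.symOpens R ⊆ Cᵍ` is the open `{τ : ℓ(Σ[τⱼ] + Σ[R] − Σ[R₀]) ≤ 1}` (semicontinuity),
  on which `ℓ = 1` (Riemann); on it the master theorem `exists_hom_symmetrize`
  (`Motives/CurveLinearSystemMaps`) gives the morphism `τ ↦ E ∼ Σ[τⱼ] + Σ[R] − Σ[R₀]` into
  `W ⊆ C⁽ᵍ⁾` (`symP`, `symW`), and `symJ R := symW ≫ chart R : symOpens R → J` has the value
  `[Σ[τⱼ] − Σ[R₀]]` on `K`-points (`comp_symJ_eq_comp_chart_iff`);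
* the `symOpens R` cover `Cᵍ` as soon as `W ≠ ∅` (`exists_mem_symOpens`: they contain every
  `K`-point — take `R ∼ Ê(E'') − Σ[τⱼ] + Σ[R₀]` effective for a `K`-point `E''` of `W` — and `Cᵍ`
  is Jacobson), the `symJ R` agree on overlaps (`symJ_compat`, a `K`-point computation through
  `comp_chart_eq_iff`), and glue (`Scheme.Cover.glueMorphisms`) to `WeilJacobian.sigma`,
  `WeilJacobian.sigmaK : Cᵍ → J` over `K` with `σ(τ) = [E − Σ[R']] ⟺ Σ[τⱼ] − Σ[R₀] ∼ Ê(E) − Σ[R']`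
  (`comp_sigmaK_eq_comp_chart_iff`);
* `σ` is surjective on `K`-points (`exists_comp_sigmaK_eq`: every class of degree `g` is
  effective), proper (`Cᵍ` proper, `J` separated), hence SURJECTIVE (`surjective_sigma`: an open
  set without `K`-points is empty, `eq_empty_of_isOpen_of_forall_pt_not_mem`);
* consequently `J` is universally closed, PROPER (`isProper_JK_hom`), irreducible hence INTEGRAL
  (`isIntegral_J`) and geometrically integral (`geometricallyIntegral_JK_hom`) over `K`.

The group law on `J` and the dimension count follow in the sequel files.

Mathlib searched (pin): `Scheme.Cover.mkOfCovers`, `Scheme.Cover.glueMorphisms`,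
`Scheme.Cover.ι_glueMorphisms`, `Scheme.Cover.hom_ext`, `IsProper.of_comp`,
`UniversallyClosed.of_comp_surjective`, `Function.Surjective.irreducibleSpace`,
`isIntegral_of_irreducibleSpace_of_isReduced`, `nonempty_inter_closedPoints` (all used).

## References

* J. S. Milne, *Jacobian Varieties*, in Cornell–Silverman (eds.), *Arithmetic Geometry* (1986),
  §5 Thm. 5.1 and §7 Thm. 7.1 (Weil's construction; the map `C^{(g)} → J`). [Milne1986JacobianVarieties]
* A. Weil, *Variétés abéliennes et courbes algébriques*, Hermann (1948). [Weil1948VarietesAbeliennes]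
-/

noncomputable section

universe u

open CategoryTheory CategoryTheory.Limits AlgebraicGeometry MonoidalCategory CartesianMonoidalCategory
  TopologicalSpace
open Literature.NumberTheory.DiophantineGeometry
open Literature.NumberTheory.DiophantineGeometry.AlgFunctionField
open Literature.AlgebraicGeometry.RelativeSpec

namespace Literature.AlgebraicGeometry.Motives

open RatFn FieldPoint CartierDivisor CurvePlaces

/-! ### Open sets without `K`-points are empty -/

section NoPoints

variable {K : Type u} [Field K] [IsAlgClosed K] {X : SchemeOver K} [LocallyOfFiniteType X.hom]

/-- **An open set of a `K`-scheme locally of finite type (`K = K̄`) containing no `K`-point is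
empty** (it is Jacobson: a non-empty open set contains a closed point). [folklore] -/
theorem eq_empty_of_isOpen_of_forall_pt_not_mem {U : Set X.left} (hU : IsOpen U)
    (h : ∀ z : AlgPoints X K, z.pt ∉ U) : U = ∅ := by
  haveI : JacobsonSpace X.left := LocallyOfFiniteType.jacobsonSpace X.hom
  by_contra hne
  obtain ⟨x, hxU, hxc⟩ := nonempty_inter_closedPoints (Set.nonempty_iff_ne_empty.mpr hne) hU.isLocallyClosed
  obtain ⟨z, hz⟩ := AlgPoints.exists_pt_eq_of_isClosed_singleton (X := X) (mem_closedPoints_iff.mp hxc)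
  exact h z (hz ▸ hxU)

omit [LocallyOfFiniteType (Over.hom X)] in
/-- **A morphism of `K`-schemes locally of finite type (`K = K̄`) with closed image which is
surjective on `K`-points is surjective.** [folklore] -/
theorem surjective_of_isClosed_range_of_forall_exists {Y : SchemeOver K} [LocallyOfFiniteType Y.hom] (f : X ⟶ Y)
    (hf : IsClosed (Set.range f.left)) (h : ∀ z : AlgPoints Y K, ∃ x : AlgPoints X K, x ≫ f = z) :
    Function.Surjective f.left := by
  rw [← Set.range_eq_univ, ← Set.compl_empty_iff]
  refine eq_empty_of_isOpen_of_forall_pt_not_mem hf.isOpen_compl fun z hz ↦ hz ?_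
  obtain ⟨x, rfl⟩ := h z
  exact ⟨x.pt, (AlgPoints.pt_comp f x).symm⟩

end NoPoints

namespace WeilJacobian

variable {K : Type u} [Field K] [IsAlgClosed K] [CharZero K]
  (C : SchemeOver K) [IsIntegral C.left] [SmoothOfRelativeDimension 1 C.hom] [IsProper C.hom]
  [GeometricallyIntegral C.hom] (hC : IsProjectiveOver C) (hX : CechPseudoCoherentAt C) (g : ℕ)
  (hg : (genus K (curveBC C (strPt (K := K) K)).left.functionField : ℤ) ≤ g)
  (R₀ : Fin g → AlgPoints C K)

/-! ### The pieces `{τ : ℓ(Σ[τⱼ] + Σ[R] − Σ[R₀]) ≤ 1} ⊆ Cᵍ` and the maps `τ ↦ [Σ[τⱼ] − Σ[R₀]]` -/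

/-- **The open `{τ ∈ Cᵍ : ℓ(Σ[τⱼ] + Σ[R] − Σ[R₀]) ≤ 1}`** on which `τ ↦ [Σ[τⱼ] − Σ[R₀]]` is computed
in the chart `R`. [cite: Milne1986JacobianVarieties, §7 (Weil's construction)] -/
def symOpens (R : Fin g → AlgPoints C K) : (powC C g).left.Opens :=
  opensOfAlgPoints (powC C g)
    (fun τ ↦ ell (coordDivisorAt C g (strPt (K := K) K) τ + tupleDiv C R - tupleDiv C R₀) ≤ 1)

omit [CharZero K] in
include hX in
/-- `K`-points of `symOpens R`. [folklore] -/
theorem pt_mem_symOpens_iff (R : Fin g → AlgPoints C K) (τ : AlgPoints (powC C g) K) :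
    τ.pt ∈ symOpens C g R₀ R ↔ ell (coordDivisorAt C g (strPt (K := K) K) τ + tupleDiv C R - tupleDiv C R₀) ≤ 1 := by
  refine pt_mem_opensOfAlgPoints_iff ?_ τ
  obtain ⟨U, hU⟩ := exists_opens_powC_pt_mem_iff C hX g 1 R R₀
  refine ⟨U, fun z ↦ ?_⟩
  rw [← tuplePt_comp_coord C g _ z, hU, coordDivisorAt_tuplePt_eq_tupleDiv]

omit [CharZero K] in
include hX hg in
/-- On `symOpens R`: `ℓ(Σ[τⱼ] + Σ[R] − Σ[R₀]) = 1`. [folklore] -/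
theorem ell_eq_one_of_pt_mem_symOpens (R : Fin g → AlgPoints C K) (τ : AlgPoints (powC C g) K)
    (hτ : τ.pt ∈ symOpens C g R₀ R) :
    ell (coordDivisorAt C g (strPt (K := K) K) τ + tupleDiv C R - tupleDiv C R₀) = 1 := by
  refine le_antisymm ((pt_mem_symOpens_iff C hX g R₀ R τ).mp hτ) (one_le_ell_of_degree_eq C g hg ?_)
  rw [map_sub, map_add, ← tuplePt_comp_coord C g _ τ, coordDivisorAt_tuplePt_eq_tupleDiv, degree_tupleDiv,
    degree_tupleDiv, degree_tupleDiv]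
  ring

/-- `symOpens R` as a `K`-scheme. [folklore] -/
abbrev symK (R : Fin g → AlgPoints C K) : SchemeOver K := overMk ((symOpens C g R₀ R).ι ≫ (powC C g).hom)

/-- The inclusion `symOpens R ↪ Cᵍ` over `K`. [folklore] -/
abbrev ιsym (R : Fin g → AlgPoints C K) : symK C g R₀ R ⟶ powC C g := Over.homMk (symOpens C g R₀ R).ι rfl

/-- `ιsym` is an open immersion. [folklore] -/
instance isOpenImmersion_ιsym_left (R : Fin g → AlgPoints C K) : IsOpenImmersion (ιsym C g R₀ R).left :=
  inferInstanceAs (IsOpenImmersion (symOpens C g R₀ R).ι)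

/-- `symOpens R → Spec K` is locally of finite type. [folklore] -/
instance locallyOfFiniteType_symK_hom (R : Fin g → AlgPoints C K) : LocallyOfFiniteType (symK C g R₀ R).hom := by
  show LocallyOfFiniteType ((symOpens C g R₀ R).ι ≫ (powC C g).hom)
  infer_instance

/-- `symOpens R` is reduced. [folklore] -/
instance isReduced_symK_left (R : Fin g → AlgPoints C K) : IsReduced (symK C g R₀ R).left := by
  show IsReduced (symOpens C g R₀ R : Scheme.{u})
  infer_instance

omit [IsAlgClosed K] [CharZero K] [AlgebraicGeometry.IsIntegral (Over.left C)] in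
/-- A `K`-point of `symOpens R`, seen in `Cᵍ`, lies in `symOpens R`. [folklore] -/
theorem pt_comp_ιsym_mem (R : Fin g → AlgPoints C K) (t : AlgPoints (symK C g R₀ R) K) :
    AlgPoints.pt (t ≫ ιsym C g R₀ R) ∈ symOpens C g R₀ R := by
  rw [AlgPoints.pt_comp]
  exact (t.pt : symOpens C g R₀ R).2

omit [IsAlgClosed K] [CharZero K] [AlgebraicGeometry.IsIntegral (Over.left C)] in
/-- A `K`-point of `Cᵍ` in `symOpens R` is a `K`-point of `symOpens R`. [folklore] -/
theorem exists_comp_ιsym_eq (R : Fin g → AlgPoints C K) (τ : AlgPoints (powC C g) K) (hτ : τ.pt ∈ symOpens C g R₀ R) :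
    ∃ t : AlgPoints (symK C g R₀ R) K, t ≫ ιsym C g R₀ R = τ :=
  AlgPoints.exists_comp_eq_of_mem_range (ιsym C g R₀ R) τ (by
    show τ.pt ∈ Set.range (symOpens C g R₀ R).ι
    rwa [Scheme.Opens.range_ι])

open Classical in
/-- **The symmetrisation map into `C⁽ᵍ⁾` in chart `R`**: `τ ↦ E ∼ Σ[τⱼ] + Σ[R] − Σ[R₀]` on
`symOpens R` (the master theorem `exists_hom_symmetrize`; the plain image if the open is empty). [cite: Milne1986JacobianVarieties, §7 (Weil's construction)] -/
def symP (R : Fin g → AlgPoints C K) : symK C g R₀ R ⟶ symPowProj C hC g :=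
  if h : (symOpens C g R₀ R : Set (powC C g).left).Nonempty then
    (Over.isoMk (Iso.refl _) rfl : symK C g R₀ R ≅ Over.mk ((symOpens C g R₀ R).ι ≫ (powC C g).hom)).hom ≫
      Classical.choose (exists_hom_symmetrize C hC hX g hg R R₀ rfl (symOpens C g R₀ R) h
        (ell_eq_one_of_pt_mem_symOpens C hX g hg R₀ R))
  else ιsym C g R₀ R ≫ symPowProj.mk C hC g

/-- **The defining property of the symmetrisation map on `K`-points.** [cite: Milne1986JacobianVarieties, §7 (Weil's construction)] -/
theorem symP_spec (R : Fin g → AlgPoints C K) (t : AlgPoints (symK C g R₀ R) K) (R₁ : Fin g → AlgPoints C K)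
    (h : Divisor.IsLinearlyEquivalent (tupleDiv C R₁)
      (coordDivisorAt C g (strPt (K := K) K) (t ≫ ιsym C g R₀ R) + tupleDiv C R - tupleDiv C R₀)) :
    t ≫ symP C hC hX g hg R₀ R = tuplePt C (strPt (K := K) K) R₁ ≫ symPowProj.mk C hC g := by
  have hne : (symOpens C g R₀ R : Set (powC C g).left).Nonempty := ⟨_, (t.pt : symOpens C g R₀ R).2⟩
  have e : symP C hC hX g hg R₀ R = (Over.isoMk (Iso.refl _) rfl : symK C g R₀ R ≅
      Over.mk ((symOpens C g R₀ R).ι ≫ (powC C g).hom)).hom ≫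
        Classical.choose (exists_hom_symmetrize C hC hX g hg R R₀ rfl (symOpens C g R₀ R) hne
          (ell_eq_one_of_pt_mem_symOpens C hX g hg R₀ R)) := dif_pos hne
  rw [e, ← Category.assoc]
  refine Classical.choose_spec (exists_hom_symmetrize C hC hX g hg R R₀ rfl (symOpens C g R₀ R) hne
    (ell_eq_one_of_pt_mem_symOpens C hX g hg R₀ R)) _ R₁ ?_
  have ht : (t ≫ (Over.isoMk (Iso.refl _) rfl : symK C g R₀ R ≅ Over.mk ((symOpens C g R₀ R).ι ≫ (powC C g).hom)).hom) ≫
      Over.homMk (symOpens C g R₀ R).ι rfl = t ≫ ιsym C g R₀ R := by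
    ext : 1
    show (t.left ≫ 𝟙 _) ≫ (symOpens C g R₀ R).ι = t.left ≫ (symOpens C g R₀ R).ι
    rw [Category.comp_id]
  rw [ht]
  exact h

/-- **`Ê(symP τ) ∼ Σ[τⱼ] + Σ[R] − Σ[R₀]` and `ℓ = 1`.** [folklore] -/
theorem liftDiv_symP (R : Fin g → AlgPoints C K) (t : AlgPoints (symK C g R₀ R) K) :
    (liftDiv C g hC (t ≫ symP C hC hX g hg R₀ R)).IsLinearlyEquivalent
        (coordDivisorAt C g (strPt (K := K) K) (t ≫ ιsym C g R₀ R) + tupleDiv C R - tupleDiv C R₀) ∧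
      ell (liftDiv C g hC (t ≫ symP C hC hX g hg R₀ R)) = 1 := by
  have hdeg : (coordDivisorAt C g (strPt (K := K) K) (t ≫ ιsym C g R₀ R) + tupleDiv C R - tupleDiv C R₀).degree = g := by
    rw [map_sub, map_add, ← tuplePt_comp_coord C g _ (t ≫ ιsym C g R₀ R), coordDivisorAt_tuplePt_eq_tupleDiv,
      degree_tupleDiv, degree_tupleDiv, degree_tupleDiv]
    ring
  obtain ⟨R₁, hR₁⟩ := exists_tuple_isLinearlyEquivalent C hdeg hg
  replace hR₁ : (tupleDiv C R₁).IsLinearlyEquivalent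
      (coordDivisorAt C g (strPt (K := K) K) (t ≫ ιsym C g R₀ R) + tupleDiv C R - tupleDiv C R₀) := hR₁
  rw [symP_spec C hC hX g hg R₀ R t R₁ hR₁, liftDiv_tuplePt_mk]
  refine ⟨hR₁, ?_⟩
  rw [Divisor.IsLinearlyEquivalent.ell_eq hR₁]
  exact ell_eq_one_of_pt_mem_symOpens C hX g hg R₀ R _ (pt_comp_ιsym_mem C g R₀ R t)

/-- The symmetrisation map lands in `W`. [folklore] -/
theorem range_symP_subset (R : Fin g → AlgPoints C K) :
    Set.range (symP C hC hX g hg R₀ R).left ⊆ Set.range (chartWOpens C g hC hX).ι := by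
  rw [Scheme.Opens.range_ι]
  rintro _ ⟨p, rfl⟩
  exact forall_mem_of_forall_pt_mem (symP C hC hX g hg R₀ R) (isOpen_chartW C g hC hX)
    (fun t ↦ (pt_mem_chartW_iff C g hC _).mpr (liftDiv_symP C hC hX g hg R₀ R t).2) p

/-- **The symmetrisation map into the chart `W`.** [folklore] -/
def symW (R : Fin g → AlgPoints C K) : symK C g R₀ R ⟶ WK C hC hX g :=
  Over.homMk (IsOpenImmersion.lift (chartWOpens C g hC hX).ι (symP C hC hX g hg R₀ R).left
    (range_symP_subset C hC hX g hg R₀ R)) (by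
      show IsOpenImmersion.lift _ _ _ ≫ (chartWOpens C g hC hX).ι ≫ (symPowProj C hC g).hom = _
      rw [IsOpenImmersion.lift_fac_assoc]
      exact Over.w (symP C hC hX g hg R₀ R))

/-- `symW ≫ ιW = symP`. [folklore] -/
@[reassoc (attr := simp)]
theorem symW_ιW (R : Fin g → AlgPoints C K) : symW C hC hX g hg R₀ R ≫ ιW C hC hX g = symP C hC hX g hg R₀ R := by
  ext : 1
  exact IsOpenImmersion.lift_fac _ _ _

/-- **The map `τ ↦ [Σ[τⱼ] − Σ[R₀]]` on the piece `symOpens R`, through the chart `R`.** [cite: Milne1986JacobianVarieties, §7 (Weil's construction)] -/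
def symJ (R : Fin g → AlgPoints C K) : symK C g R₀ R ⟶ JK C hC hX g hg := symW C hC hX g hg R₀ R ≫ chart C hC hX g hg R

include hg in
/-- **The value of `symJ` on a `K`-point is the class `[Σ[τⱼ] − Σ[R₀]]`**: it equals `[E − Σ[R']]`
iff `Σ[τⱼ] − Σ[R₀] ∼ Ê(E) − Σ[R']`. [folklore] -/
theorem comp_symJ_eq_comp_chart_iff (R R' : Fin g → AlgPoints C K) (t : AlgPoints (symK C g R₀ R) K)
    (x : AlgPoints (WK C hC hX g) K) :
    t ≫ symJ C hC hX g hg R₀ R = x ≫ chart C hC hX g hg R' ↔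
      (coordDivisorAt C g (strPt (K := K) K) (t ≫ ιsym C g R₀ R) - tupleDiv C R₀).IsLinearlyEquivalent
        (liftDiv C g hC (x ≫ ιW C hC hX g) - tupleDiv C R') := by
  rw [symJ, ← Category.assoc, comp_chart_eq_iff, Category.assoc, symW_ιW]
  obtain ⟨hlin, -⟩ := liftDiv_symP C hC hX g hg R₀ R t
  have h1 : (liftDiv C g hC (t ≫ symP C hC hX g hg R₀ R) - tupleDiv C R).IsLinearlyEquivalent
      (coordDivisorAt C g (strPt (K := K) K) (t ≫ ιsym C g R₀ R) - tupleDiv C R₀) :=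
    Divisor.IsLinearlyEquivalent.trans' (Divisor.IsLinearlyEquivalent.of_eq' (by abel))
      (Divisor.IsLinearlyEquivalent.trans' (Divisor.IsLinearlyEquivalent.add_right' hlin (-tupleDiv C R))
        (Divisor.IsLinearlyEquivalent.of_eq' (by abel)))
  exact ⟨fun h ↦ Divisor.IsLinearlyEquivalent.trans' (Divisor.IsLinearlyEquivalent.symm' h1) h,
    fun h ↦ Divisor.IsLinearlyEquivalent.trans' h1 h⟩

/-! ### The pieces cover `Cᵍ` -/

variable (hW : (chartW C g hC).Nonempty)

omit [CharZero K] in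
include hW in
/-- `W` has a `K`-point. [folklore] -/
theorem exists_algPoint_WK : Nonempty (AlgPoints (WK C hC hX g) K) := by
  haveI := symPowProj.locallyOfFiniteType_hom C hC g
  by_contra h
  have he := eq_empty_of_isOpen_of_forall_pt_not_mem (X := symPowProj C hC g) (isOpen_chartW C g hC hX)
    fun y hy ↦ h (exists_comp_ιW_eq C hC hX g y hy).nonempty
  exact hW.ne_empty he

omit [CharZero K] in
include hX hg hW in
/-- **Every `K`-point of `Cᵍ` lies in some piece**: for a general `E'' ∈ W` and `R` effective with
`Σ[R] ∼ Ê(E'') − Σ[τⱼ] + Σ[R₀]` (degree `g ≥ genus`), `ℓ(Σ[τⱼ] + Σ[R] − Σ[R₀]) = ℓ(Ê(E'')) = 1`. [folklore] -/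
theorem exists_pt_mem_symOpens (τ : AlgPoints (powC C g) K) : ∃ R : Fin g → AlgPoints C K, τ.pt ∈ symOpens C g R₀ R := by
  obtain ⟨x⟩ := exists_algPoint_WK C hC hX g hW
  have hdeg : (liftDiv C g hC (x ≫ ιW C hC hX g) - coordDivisorAt C g (strPt (K := K) K) τ + tupleDiv C R₀).degree = g := by
    rw [map_add, map_sub, ← tuplePt_comp_coord C g _ τ, coordDivisorAt_tuplePt_eq_tupleDiv, degree_liftDiv,
      degree_tupleDiv, degree_tupleDiv]
    ring
  obtain ⟨R, hR⟩ := exists_tuple_isLinearlyEquivalent C hdeg hg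
  replace hR : (tupleDiv C R).IsLinearlyEquivalent
      (liftDiv C g hC (x ≫ ιW C hC hX g) - coordDivisorAt C g (strPt (K := K) K) τ + tupleDiv C R₀) := hR
  refine ⟨R, (pt_mem_symOpens_iff C hX g R₀ R τ).mpr ?_⟩
  have key : (coordDivisorAt C g (strPt (K := K) K) τ + tupleDiv C R - tupleDiv C R₀).IsLinearlyEquivalent
      (liftDiv C g hC (x ≫ ιW C hC hX g)) :=
    Divisor.IsLinearlyEquivalent.trans' (Divisor.IsLinearlyEquivalent.of_eq' (by abel))
      (Divisor.IsLinearlyEquivalent.trans'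
        (Divisor.IsLinearlyEquivalent.add_right' hR (coordDivisorAt C g (strPt (K := K) K) τ - tupleDiv C R₀))
        (Divisor.IsLinearlyEquivalent.of_eq' (by abel)))
  rw [Divisor.IsLinearlyEquivalent.ell_eq key]
  exact (ell_liftDiv_comp_ιW C hC hX g x).le

omit [CharZero K] in
include hX hg hW in
/-- **The pieces `symOpens R` cover `Cᵍ`** (they cover the `K`-points, and `Cᵍ` is Jacobson). [folklore] -/
theorem exists_mem_symOpens (p : (powC C g).left) : ∃ R : Fin g → AlgPoints C K, p ∈ symOpens C g R₀ R := by
  have h := eq_univ_of_isOpen_of_forall_pt_mem (X := powC C g) (U := ⋃ R : Fin g → AlgPoints C K,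
      (symOpens C g R₀ R : Set (powC C g).left)) (isOpen_iUnion fun R ↦ (symOpens C g R₀ R).isOpen)
    (fun τ ↦ Set.mem_iUnion.mpr (exists_pt_mem_symOpens C hC hX g hg R₀ hW τ))
  have hp : p ∈ ⋃ R : Fin g → AlgPoints C K, (symOpens C g R₀ R : Set (powC C g).left) := h ▸ Set.mem_univ p
  exact Set.mem_iUnion.mp hp

/-- **The open cover of `Cᵍ` by the pieces.** [folklore] -/
def symCover : (powC C g).left.OpenCover :=
  Scheme.Cover.mkOfCovers (Fin g → AlgPoints C K) (fun R ↦ (symOpens C g R₀ R : Scheme.{u}))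
    (fun R ↦ (symOpens C g R₀ R).ι) fun p ↦ by
      obtain ⟨R, hp⟩ := exists_mem_symOpens C hC hX g hg R₀ hW p
      exact ⟨R, ⟨p, hp⟩, rfl⟩

/-! ### Gluing: the morphism `σ : Cᵍ → J`, `τ ↦ [Σ[τⱼ] − Σ[R₀]]` -/

/-- The intersection of two pieces as a `K`-scheme. [folklore] -/
abbrev QK (R R' : Fin g → AlgPoints C K) : SchemeOver K :=
  overMk (pullback.fst (symOpens C g R₀ R).ι (symOpens C g R₀ R').ι ≫ (symOpens C g R₀ R).ι ≫ (powC C g).hom)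

/-- First projection of the intersection. [folklore] -/
abbrev qfst (R R' : Fin g → AlgPoints C K) : QK C g R₀ R R' ⟶ symK C g R₀ R :=
  Over.homMk (pullback.fst (symOpens C g R₀ R).ι (symOpens C g R₀ R').ι) rfl

/-- Second projection of the intersection. [folklore] -/
abbrev qsnd (R R' : Fin g → AlgPoints C K) : QK C g R₀ R R' ⟶ symK C g R₀ R' :=
  Over.homMk (pullback.snd (symOpens C g R₀ R).ι (symOpens C g R₀ R').ι) (by
    show pullback.snd _ _ ≫ (symOpens C g R₀ R').ι ≫ (powC C g).hom =
      pullback.fst _ _ ≫ (symOpens C g R₀ R).ι ≫ (powC C g).hom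
    rw [← pullback.condition_assoc])

omit [IsAlgClosed K] [CharZero K] [AlgebraicGeometry.IsIntegral (Over.left C)] in
/-- The two projections agree in `Cᵍ`. [folklore] -/
theorem qfst_ιsym (R R' : Fin g → AlgPoints C K) :
    qfst C g R₀ R R' ≫ ιsym C g R₀ R = qsnd C g R₀ R R' ≫ ιsym C g R₀ R' := by
  ext : 1
  exact pullback.condition

/-- The intersection is locally of finite type over `K`. [folklore] -/
instance locallyOfFiniteType_QK_hom (R R' : Fin g → AlgPoints C K) : LocallyOfFiniteType (QK C g R₀ R R').hom := by
  show LocallyOfFiniteType (pullback.fst (symOpens C g R₀ R).ι (symOpens C g R₀ R').ι ≫ (symOpens C g R₀ R).ι ≫ (powC C g).hom)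
  infer_instance

/-- The intersection is reduced. [folklore] -/
instance isReduced_QK_left (R R' : Fin g → AlgPoints C K) : IsReduced (QK C g R₀ R R').left :=
  isReduced_of_isOpenImmersion (pullback.fst (symOpens C g R₀ R).ι (symOpens C g R₀ R').ι)

include hg in
/-- **The maps `symJ R` agree on overlaps** (both are `τ ↦ [Σ[τⱼ] − Σ[R₀]]` on `K`-points). [folklore] -/
theorem symJ_compat (R R' : Fin g → AlgPoints C K) :
    pullback.fst (symOpens C g R₀ R).ι (symOpens C g R₀ R').ι ≫ (symJ C hC hX g hg R₀ R).left =
      pullback.snd (symOpens C g R₀ R).ι (symOpens C g R₀ R').ι ≫ (symJ C hC hX g hg R₀ R').left := by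
  have key : qfst C g R₀ R R' ≫ symJ C hC hX g hg R₀ R = qsnd C g R₀ R R' ≫ symJ C hC hX g hg R₀ R' := by
    refine SchemeOver.hom_ext_of_forall_algPoints K fun q ↦ ?_
    rw [← Category.assoc, ← Category.assoc]
    rw [show (q ≫ qsnd C g R₀ R R') ≫ symJ C hC hX g hg R₀ R' =
      ((q ≫ qsnd C g R₀ R R') ≫ symW C hC hX g hg R₀ R') ≫ chart C hC hX g hg R' by simp only [symJ, Category.assoc]]
    rw [comp_symJ_eq_comp_chart_iff, Category.assoc (q ≫ qsnd C g R₀ R R') (symW C hC hX g hg R₀ R') (ιW C hC hX g),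
      symW_ιW]
    obtain ⟨hlin, -⟩ := liftDiv_symP C hC hX g hg R₀ R' (q ≫ qsnd C g R₀ R R')
    have e : (q ≫ qsnd C g R₀ R R') ≫ ιsym C g R₀ R' = (q ≫ qfst C g R₀ R R') ≫ ιsym C g R₀ R := by
      rw [Category.assoc, Category.assoc, qfst_ιsym]
    rw [e] at hlin
    exact Divisor.IsLinearlyEquivalent.symm' (Divisor.IsLinearlyEquivalent.trans'
      (Divisor.IsLinearlyEquivalent.of_eq' (by abel)) (Divisor.IsLinearlyEquivalent.trans'
      (Divisor.IsLinearlyEquivalent.add_right' hlin (-tupleDiv C R')) (Divisor.IsLinearlyEquivalent.of_eq' (by abel))))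
  exact congrArg CommaMorphism.left key


/-- **The morphism `σ : Cᵍ → J`, `τ ↦ [Σ[τⱼ] − Σ[R₀]]`** (glued from the `symJ R`). [cite: Milne1986JacobianVarieties, §7 (Weil's construction; the map `C^{(g)} → J`)] -/
def sigma : (powC C g).left ⟶ J C hC hX g hg :=
  (symCover C hC hX g hg R₀ hW).glueMorphisms (fun R ↦ (symJ C hC hX g hg R₀ R).left) (symJ_compat C hC hX g hg R₀)

/-- `σ` restricted to the piece `symOpens R` is `symJ R`. [folklore] -/
theorem ι_sigma (R : Fin g → AlgPoints C K) :
    (symOpens C g R₀ R).ι ≫ sigma C hC hX g hg R₀ hW = (symJ C hC hX g hg R₀ R).left :=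
  (symCover C hC hX g hg R₀ hW).ι_glueMorphisms _ _ R

/-- **`σ : Cᵍ → J` as a morphism of `K`-schemes.** [cite: Milne1986JacobianVarieties, §7 (Weil's construction)] -/
def sigmaK : powC C g ⟶ JK C hC hX g hg :=
  Over.homMk (sigma C hC hX g hg R₀ hW) (by
    refine (symCover C hC hX g hg R₀ hW).hom_ext _ _ fun R ↦ ?_
    show (symOpens C g R₀ R).ι ≫ sigma C hC hX g hg R₀ hW ≫ Jbase C hC hX g hg = (symOpens C g R₀ R).ι ≫ (powC C g).hom
    rw [← Category.assoc, ι_sigma]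
    exact Over.w (symJ C hC hX g hg R₀ R))

/-- `ιsym R ≫ σ = symJ R`. [folklore] -/
theorem ιsym_sigmaK (R : Fin g → AlgPoints C K) :
    ιsym C g R₀ R ≫ sigmaK C hC hX g hg R₀ hW = symJ C hC hX g hg R₀ R := by
  ext : 1
  exact ι_sigma C hC hX g hg R₀ hW R

/-- **The value of `σ` on `K`-points**: `σ(τ) = [E − Σ[R']]` iff `Σ[τⱼ] − Σ[R₀] ∼ Ê(E) − Σ[R']`. [cite: Milne1986JacobianVarieties, §7 (Weil's construction)] -/
theorem comp_sigmaK_eq_comp_chart_iff (τ : AlgPoints (powC C g) K) (R' : Fin g → AlgPoints C K)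
    (x : AlgPoints (WK C hC hX g) K) :
    τ ≫ sigmaK C hC hX g hg R₀ hW = x ≫ chart C hC hX g hg R' ↔
      (coordDivisorAt C g (strPt (K := K) K) τ - tupleDiv C R₀).IsLinearlyEquivalent
        (liftDiv C g hC (x ≫ ιW C hC hX g) - tupleDiv C R') := by
  obtain ⟨R, hR⟩ := exists_pt_mem_symOpens C hC hX g hg R₀ hW τ
  obtain ⟨t, rfl⟩ := exists_comp_ιsym_eq C g R₀ R τ hR
  rw [Category.assoc, ιsym_sigmaK, comp_symJ_eq_comp_chart_iff]

/-- **`σ` is surjective on `K`-points**: `[E − Σ[R']] = σ(τ)` for `τ` a tuple with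
`Σ[τⱼ] ∼ Ê(E) − Σ[R'] + Σ[R₀]` (effective of degree `g ≥ genus`). [cite: Milne1986JacobianVarieties, §7 (Weil's construction)] -/
theorem exists_comp_sigmaK_eq (z : AlgPoints (JK C hC hX g hg) K) :
    ∃ τ : AlgPoints (powC C g) K, τ ≫ sigmaK C hC hX g hg R₀ hW = z := by
  obtain ⟨R', x, rfl⟩ := exists_comp_chart_eq C hC hX g hg z
  have hdeg : (liftDiv C g hC (x ≫ ιW C hC hX g) - tupleDiv C R' + tupleDiv C R₀).degree = g := by
    rw [map_add, map_sub, degree_liftDiv, degree_tupleDiv, degree_tupleDiv]; ring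
  obtain ⟨R₁, hR₁⟩ := exists_tuple_isLinearlyEquivalent C hdeg hg
  replace hR₁ : (tupleDiv C R₁).IsLinearlyEquivalent
      (liftDiv C g hC (x ≫ ιW C hC hX g) - tupleDiv C R' + tupleDiv C R₀) := hR₁
  refine ⟨tuplePt C (strPt (K := K) K) R₁, (comp_sigmaK_eq_comp_chart_iff C hC hX g hg R₀ hW _ R' x).mpr ?_⟩
  rw [coordDivisorAt_tuplePt_eq_tupleDiv]
  exact Divisor.IsLinearlyEquivalent.trans' (Divisor.IsLinearlyEquivalent.of_eq' (by abel))
    (Divisor.IsLinearlyEquivalent.trans' (Divisor.IsLinearlyEquivalent.add_right' hR₁ (-tupleDiv C R₀))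
    (Divisor.IsLinearlyEquivalent.of_eq' (by abel)))

/-! ### `J` is proper and geometrically integral -/

/-- `σ` is proper (`Cᵍ` is proper and `J` is separated over `K`). [folklore] -/
instance isProper_sigma : IsProper (sigma C hC hX g hg R₀ hW) := by
  haveI : IsProper (powC C g).hom := isProper_powOver_base C.hom g
  have h : IsProper (sigma C hC hX g hg R₀ hW ≫ Jbase C hC hX g hg) := by
    rw [show sigma C hC hX g hg R₀ hW ≫ Jbase C hC hX g hg = (powC C g).hom from Over.w (sigmaK C hC hX g hg R₀ hW)]
    infer_instance
  exact IsProper.of_comp (sigma C hC hX g hg R₀ hW) (Jbase C hC hX g hg)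

/-- **`σ : Cᵍ → J` is surjective.** [cite: Milne1986JacobianVarieties, §7 (Weil's construction)] -/
instance surjective_sigma : Surjective (sigma C hC hX g hg R₀ hW) :=
  ⟨surjective_of_isClosed_range_of_forall_exists (sigmaK C hC hX g hg R₀ hW)
    ((sigma C hC hX g hg R₀ hW).isClosedMap.isClosed_range) (exists_comp_sigmaK_eq C hC hX g hg R₀ hW)⟩

include R₀ hW in
/-- **`J` is universally closed over `K`.** [cite: Milne1986JacobianVarieties, §7 Thm. 7.1] -/
theorem universallyClosed_JK_hom : UniversallyClosed (JK C hC hX g hg).hom := by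
  haveI : IsProper (powC C g).hom := isProper_powOver_base C.hom g
  have h : UniversallyClosed (sigma C hC hX g hg R₀ hW ≫ Jbase C hC hX g hg) := by
    rw [show sigma C hC hX g hg R₀ hW ≫ Jbase C hC hX g hg = (powC C g).hom from Over.w (sigmaK C hC hX g hg R₀ hW)]
    infer_instance
  exact UniversallyClosed.of_comp_surjective (sigma C hC hX g hg R₀ hW) (Jbase C hC hX g hg)

include R₀ hW in
/-- **`J` is proper over `K`.** [cite: Milne1986JacobianVarieties, §7 Thm. 7.1] -/
theorem isProper_JK_hom : IsProper (JK C hC hX g hg).hom := by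
  haveI := universallyClosed_JK_hom C hC hX g hg R₀ hW
  exact {}

include R₀ hW in
/-- **`J` is integral** (irreducible as the image of the irreducible `Cᵍ`, and reduced). [cite: Milne1986JacobianVarieties, §7 Thm. 7.1] -/
theorem isIntegral_J : IsIntegral (J C hC hX g hg) := by
  haveI : IrreducibleSpace ↥(J C hC hX g hg) :=
    (sigma C hC hX g hg R₀ hW).surjective.irreducibleSpace (sigma C hC hX g hg R₀ hW).continuous
  exact isIntegral_of_irreducibleSpace_of_isReduced _

include R₀ hW in
/-- **`J` is geometrically integral over `K`** (`K` is algebraically closed). [folklore] -/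
theorem geometricallyIntegral_JK_hom : GeometricallyIntegral (JK C hC hX g hg).hom := by
  haveI := isIntegral_J C hC hX g hg R₀ hW
  exact geometricallyIntegral_of_isAlgClosed (JK C hC hX g hg).hom

end WeilJacobian

end Literature.AlgebraicGeometry.Motives

end
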